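import Summits.HodgeConjecture.CorCM.Census.DecicWeil23MultiExtraction
import Summits.HodgeConjecture.CorCM.DecicWeil23MultiSixfoldParts
import Summits.HodgeConjecture.CorCM.DecicWeil23MultiTenfoldParts
import Summits.HodgeConjecture.CorCM.DecicWeil23TripleFrameTransfer
import Summits.HodgeConjecture.CorCM.DecicCurveFivefoldHodgeOfMarkman
import HarnessLib

/-!
# COR-CM — the Hodge conjecture for every product of copies of `E, B₁, …, B_r` — ANY NUMBER of CM fivefolds of `k`-signature
# `(2,3)` over one DECIC CM field `K ⊇ k` whose types have INDEPENDENT positions, and the CM curve of `k` — GIVEN ONLY Markman's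
# hyperbolic-sixfold theorem and `2`-transitivity (frame form)

Cell `pub-hodgecm2` (COR-CM), seat b30 gen 24 (2026-08-22); count-neutral own lane DECIC-MULTI.  Theorems only; no definition, no
named fact of its own, no `sorry`.  HONEST FRAMING: CONDITIONAL on the single displayed named fact
`HodgeTheory.Markman2025_weilClasses_algebraic_hyperbolicSixfold` (arXiv:2502.03415 Thm 1.5.1, unrefereed); `HC_CM` is not asserted.

THE ASSEMBLY.  For `κ : Fin N → Fin (r+1)` let `X = ⨁_j A(κ j)` (atoms `A = (E, B₁, …, B_r)` on `multiSlots r`, `E ⊨ (k; {τ})`,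
`B_m ⊨ (K; Φ_m)` with `s ∈ Φ_m ⟺ (e s).2 = P m (e s).1`, `#I_m = 2`).  By Pohlmann–Gao–Ullmo (`Pohlmann1968_thm1_cmAlgebra`) the Hodge
classes of `X` are spanned by the lines of the `Aut(ℂ)`-balanced weights; by FRAME TRANSFER these are balanced configurations of the
census model under the realised permutations `realisedPerms e` — closed under composition and, under `h2t`, `2`-TRANSITIVE
(`DecicWeil23Pair.twoTransitive_realisedPerms`); under `IndepPos P` the INDUCTION PRINCIPLE of `Census/DecicWeil23MultiExtraction`
decomposes them into PAIR parts (divisor lines), SIXFOLD parts (the Weil weight of `B_m × E`: algebraic by Markman's sixfold theorem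
through seat b09's `DecicCurveFivefold.weilClassesOf_le_algebraicClasses_cmFivefold_prod_cmCurve_of_markmanSixfold`, type count
`(3,3)` by gen 22's `DecicWeil23Triple.typeCount_eq_three_of_reading₅`) and TENFOLD parts (`B_{m₁} × B̄_{m₂}`: push-pull through
`E ⊞ E ⊞ X`, `CorCM/DecicWeil23MultiTenfoldParts`), glued by `PairWeights.weightClassesAlg_union_le_algebraicClasses`.

* **`hodgeConjectureFor_biproduct_comp_of_frameM_of_markmanSixfold_h2t`** and the `AVDominatedBy` form.
The intrinsic form (no frame: `Φ : Fin r → CMType K` of `k`-signature `(2,3)` with independent indicator vectors on the `τ`-fibre,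
`Aut(ℂ/k)` `2`-transitive on the embeddings over `τ`) is the sequel `CorCM/DecicWeil23MultiHodgeOfMarkman.lean`.
[cite: Markman2025SecantWeil, Thm 1.5.1] [cite: Pohlmann1968, Thm 1] [cite: Milne2020HodgeClassesAV, 1.2 (a) and Thm. 1]
[cite: Deligne1982HodgeCycles, §4 Prop. 4.4 and §5 (c)] [cite: MoonenZarhin1999LowDim, Thm. 0.1 (a)] [cite: Schoen1998HodgeWeilAddendum, §10]
[cite: DixonMortimer1996, §2.1]

## References
* [Markman2025SecantWeil] E. Markman, arXiv:2502.03415 (unrefereed), Thm 1.5.1.  [Pohlmann1968] H. Pohlmann, Ann. of Math. 88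
  (1968), Thm 1.  [Milne2020HodgeClassesAV] J. S. Milne, arXiv:2010.08857, 1.2 (a), Thm. 1.  [Deligne1982HodgeCycles]
  P. Deligne, LNM 900 (1982), §4 Prop. 4.4, §5 (c).  [MoonenZarhin1999LowDim] B. Moonen, Yu. Zarhin, Math. Ann. 315 (1999),
  Thm. 0.1 (a).  [Schoen1998HodgeWeilAddendum] C. Schoen, Compositio Math. 114 (1998), §10.  [DixonMortimer1996] J. D. Dixon,
  B. Mortimer, *Permutation Groups*, GTM 163 (1996), §2.1.  [MumfordAV1970] D. Mumford, *Abelian Varieties*, §19.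
-/

noncomputable section

open CategoryTheory CategoryTheory.Limits NumberField

namespace Summit.HodgeConjecture.CorCM.DecicWeil23Multi

open Literature.AlgebraicGeometry Literature.AlgebraicGeometry.Motives Literature.AlgebraicGeometry.HodgeTheory
open Literature.AlgebraicGeometry.ComplexMultiplication (IsCMTypeRealisation)
open Literature.AlgebraicGeometry.Pohlmann1968
open Literature.AlgebraicTopology.SingularHomology
open Literature.NumberTheory.ComplexMultiplication
open Summit.HodgeConjecture.CorCM.Census.DecicWeil23Multi (PtM IndepPos ModelBalancedM IsPairPartM IsSixPartM IsTenPartM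
  modelBalancedM_induction)
open Summit.HodgeConjecture.CorCM.DecicWeil23Pair (realisedPerms mul_mem_realisedPerms twoTransitive_realisedPerms)
open Summit.HodgeConjecture.CorCM.DecicWeil23Triple (typeCount_eq_three_of_reading₅)
open Summit.HodgeConjecture.CorCM.DecicCurveFivefold (weilClassesOf_le_algebraicClasses_cmFivefold_prod_cmCurve_of_markmanSixfold)
open Summit.HodgeConjecture.CorCM.PairWeights

open scoped Classical Pointwise

section Assembly

variable {I : Type} {r : ℕ} {Kf : I → Type} [∀ i, Field (Kf i)] [∀ i, NumberField (Kf i)] [∀ i, IsCMField (Kf i)]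
  {i₀ i₁ : I} {τ : Kf i₀ →+* ℂ} {e : (Kf i₁ →+* ℂ) ≃ Fin 5 × Bool} {i : Kf i₀ →+* Kf i₁} {P : Fin r → Fin 5 → Bool}
  {A : Fin (r + 1) → AbelianVariety ℂ} {Φ : ∀ j : Fin (r + 1), CMType (Kf (multiSlots r i₀ i₁ j))}
  {ι : ∀ j, 𝓞 (Kf (multiSlots r i₀ i₁ j)) →+* End (A j)}
  {θ : ∀ j, Kf (multiSlots r i₀ i₁ j) →+* Module.End ℂ (complexBetti (A j).X 1)}

/-! ### The Weil planes of the sixfolds `B_m × E`, from Markman's theorem -/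

/-- **The Weil planes of the sixfolds `(B_m × E, ι(iδ) × ι(δ))` are algebraic, GIVEN Markman's hyperbolic-sixfold theorem** — seat
b09's aiming theorem `DecicCurveFivefold.weilClassesOf_le_algebraicClasses_cmFivefold_prod_cmCurve_of_markmanSixfold` (Weil type
`(3,3)`) fed with the type count of a `(2,3)`-reading (`#I_m = 2`). [cite: Markman2025SecantWeil, Thm 1.5.1]
[cite: MoonenZarhin1999LowDim, Thm. 0.1 (a)] [cite: Deligne1982HodgeCycles, §4 Prop. 4.4] -/
theorem weilClassesOf_sixfold_le_algebraicClasses_of_frameM_of_markmanSixfold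
    (hM6 : Markman2025_weilClasses_algebraic_hyperbolicSixfold)
    (h10 : Module.finrank ℚ (Kf i₁) = 10) (h2 : Module.finrank ℚ (Kf i₀) = 2) (i : Kf i₀ →+* Kf i₁)
    {δ : 𝓞 (Kf i₀)} {d : ℕ} (hd : 0 < d) (hδ : ((δ : Kf i₀)) ^ 2 = -(d : Kf i₀))
    (hA : ∀ j, IsCMTypeRealisation (Φ j) (A j) (ι j) (θ j))
    (he_sign : ∀ s : Kf i₁ →+* ℂ, (e s).2 = true ↔ s.comp i = τ)
    (hP : ∀ m, ((Finset.univ : Finset (Fin 5)).filter fun a => P m a = true).card = 2)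
    (hΦ : ∀ (m : Fin r) (s : Kf i₁ →+* ℂ), s ∈ (Φ m.succ).1 ↔ (e s).2 = P m (e s).1)
    (hΨ : ∀ σ : Kf i₀ →+* ℂ, σ ∈ (Φ 0).1 ↔ σ = τ) (m : Fin r) :
    weilClassesOf ((A m.succ).prod (A 0))
      (AbelianVariety.prodLift (AbelianVariety.fst (A m.succ) (A 0) ≫ ι m.succ (RingOfIntegers.mapRingHom i δ))
        (AbelianVariety.snd (A m.succ) (A 0) ≫ ι 0 δ)) 3 d ≤
      algebraicClasses ((A m.succ).prod (A 0)).X 3 :=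
  weilClassesOf_le_algebraicClasses_cmFivefold_prod_cmCurve_of_markmanSixfold hM6 h10 h2 i (hA m.succ) (hA 0) hd hδ
    (typeCount_eq_three_of_reading₅ h2 he_sign (hP m) (hΦ m) hΨ)

/-! ### Assembly -/

/-- **MAIN THEOREM (frame form).  The Hodge conjecture for every product of copies `⨁_j A(κ j)` of `E, B₁, …, B_r` — i.e. for
`E^a × B₁^{n₁} × ⋯ × B_r^{n_r}`, all exponents, any order — GIVEN ONLY Markman's hyperbolic-sixfold theorem**, for `E ⊨ (k; {τ})`
(`δ ∈ 𝓞_k`, `δ² = −d`, `τ(δ) = i√d`), `B_m ⊨ (K; Φ_(m+1))` CM fivefolds of `k`-signature `(2,3)` over a decic CM field `K ⊇ i(k)`, the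
types read in a frame `e` at positions `P m` (`hΦ`, `#I_m = 2`) that are INDEPENDENT (`hind : IndepPos P` — the columns
`𝟙, 𝟙_{I_1}, …, 𝟙_{I_r}` are linearly independent), the conjugate pairs permuted `2`-TRANSITIVELY by `Aut(ℂ)` (`h2t`).  Leaf: the
Markman fact ONLY. [cite: Markman2025SecantWeil, Thm 1.5.1] [cite: Pohlmann1968, Thm 1] [cite: Milne2020HodgeClassesAV, 1.2 (a) and Thm. 1]
[cite: Schoen1998HodgeWeilAddendum, §10] [cite: DixonMortimer1996, §2.1] -/
theorem hodgeConjectureFor_biproduct_comp_of_frameM_of_markmanSixfold_h2t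
    (hM6 : Markman2025_weilClasses_algebraic_hyperbolicSixfold)
    {N : ℕ} (κ : Fin N → Fin (r + 1)) (h10 : Module.finrank ℚ (Kf i₁) = 10) (h2 : Module.finrank ℚ (Kf i₀) = 2)
    (i : Kf i₀ →+* Kf i₁) {δ : 𝓞 (Kf i₀)} {d : ℕ} (hd : 0 < d) (hδ : ((δ : Kf i₀)) ^ 2 = -(d : Kf i₀))
    (hτ : τ (δ : Kf i₀) = Complex.I * (Real.sqrt d : ℂ))
    (hA : ∀ j, IsCMTypeRealisation (Φ j) (A j) (ι j) (θ j))
    (e : (Kf i₁ →+* ℂ) ≃ Fin 5 × Bool)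
    (he_sign : ∀ s : Kf i₁ →+* ℂ, (e s).2 = true ↔ s.comp i = τ)
    (he_conj : ∀ s : Kf i₁ →+* ℂ, e (ComplexEmbedding.conjugate s) = ((e s).1, !(e s).2))
    (hP : ∀ m, ((Finset.univ : Finset (Fin 5)).filter fun a => P m a = true).card = 2) (hind : IndepPos P)
    (hΦ : ∀ (m : Fin r) (s : Kf i₁ →+* ℂ), s ∈ (Φ m.succ).1 ↔ (e s).2 = P m (e s).1)
    (hΨ : ∀ σ : Kf i₀ →+* ℂ, σ ∈ (Φ 0).1 ↔ σ = τ)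
    (h2t : ∀ a b : Fin 5, a ≠ b → ∃ ρ : ℂ ≃+* ℂ,
      (ρ : ℂ →+* ℂ).comp (e.symm (a, true)) = e.symm (0, true) ∧ (ρ : ℂ →+* ℂ).comp (e.symm (b, true)) = e.symm (1, true)) :
    HodgeConjectureFor (⨁ fun j => A (κ j)).dim (⨁ fun j => A (κ j)).X := by
  have hττ : ComplexEmbedding.conjugate τ ≠ τ := QuarticCM.conjugate_ne τ
  have hk : ∀ σ : Kf i₀ →+* ℂ, σ = τ ∨ σ = ComplexEmbedding.conjugate τ := fun σ =>
    QuarticCM.eq_or_eq_conjugate_of_quadratic h2 τ σ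
  -- the realised permutations: closed under composition, `2`-transitive
  have hmul := mul_mem_realisedPerms e
  have h2p := twoTransitive_realisedPerms he_sign h2t
  -- the Weil planes of the `B_m × E`, algebraic by Markman's sixfold theorem
  have hW := weilClassesOf_sixfold_le_algebraicClasses_of_frameM_of_markmanSixfold hM6 h10 h2 i hd hδ hA he_sign hP hΦ hΨ
  -- sixfold parts of any product of copies (used on `X` and on `X⁺ = E ⊞ E ⊞ X`)
  have hsix : ∀ {N' : ℕ} (κ' : Fin N' → Fin (r + 1)) (m : Fin r) (c' : Bool)
      (G' : Finset ((j : Fin N') × (Kf (multiSlots r i₀ i₁ (κ' j)) →+* ℂ))),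
      IsSixPartM (fun x => toPtM e τ ((Sigma.map κ' (fun _ => id) :
        ((j : Fin N') × (Kf (multiSlots r i₀ i₁ (κ' j)) →+* ℂ)) → ((l : Fin (r + 1)) × (Kf (multiSlots r i₀ i₁ l) →+* ℂ))) x))
          m c' G' →
      G'.card = 2 * 3 ∧ weightClassesAlg (fun j => A (κ' j)) (fun j => ι (κ' j)) (2 * 3) G' ≤
        algebraicClasses (⨁ fun j => A (κ' j)).X 3 :=
    fun κ' m c' G' hG' => weightClassesAlg_le_algebraicClasses_of_isSixPartM hk he_sign hA hτ hW κ' hG'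
  refine ⟨nonempty_hodgeModel_holds (Motives.AbelianVariety.isSmoothProjective_holds (A := ⨁ fun j => A (κ j))),
    fun p cl hc hH => ?_⟩
  have hAκ : ∀ j, IsCMTypeRealisation (Φ (κ j)) (A (κ j)) (ι (κ j)) (θ (κ j)) := fun j => hA (κ j)
  -- every balanced configuration has algebraic weight lines: induct over its generating parts
  have key : ∀ (S : Finset ((j : Fin N) × (Kf (multiSlots r i₀ i₁ (κ j)) →+* ℂ))),
      ModelBalancedM P (realisedPerms e) (fun x => toPtM e τ ((Sigma.map κ (fun _ => id) :
        ((j : Fin N) × (Kf (multiSlots r i₀ i₁ (κ j)) →+* ℂ)) → ((m : Fin (r + 1)) × (Kf (multiSlots r i₀ i₁ m) →+* ℂ))) x)) S →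
      ∀ q, S.card = 2 * q → weightClassesAlg (fun j => A (κ j)) (fun j => ι (κ j)) (2 * q) S ≤
        algebraicClasses (⨁ fun j => A (κ j)).X q := by
    intro S hS
    refine modelBalancedM_induction hP hind hmul h2p (motive := fun S => ∀ q, S.card = 2 * q →
      weightClassesAlg (fun j => A (κ j)) (fun j => ι (κ j)) (2 * q) S ≤ algebraicClasses (⨁ fun j => A (κ j)).X q)
      (fun q hq => ?_) (fun G S' hGS hG ih q hq => ?_) (fun G S' m b hGS hG ih q hq => ?_)
      (fun G S' m₁ m₂ hGS hG ih q hq => ?_) hS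
    · obtain rfl : q = 0 := by simpa using hq.symm
      exact fun c' _ => hodgeConjectureFor_codim_zero c'
    · -- a pair part: a divisor line
      obtain ⟨ha, hGalg⟩ := weightClassesAlg_le_algebraicClasses_of_isPairPartM κ hττ hk he_conj hA hG
      have hRcard : S'.card = 2 * (q - 1) := by
        have h := Finset.card_union_of_disjoint hGS; rw [hq, ha] at h; omega
      have haq : 1 + (q - 1) = q := by
        have h := Finset.card_union_of_disjoint hGS; rw [hq, ha] at h; omega
      rw [← Finset.disjUnion_eq_union G S' hGS]
      exact weightClassesAlg_union_le_algebraicClasses hAκ haq ha hRcard hGS hGalg (ih (q - 1) hRcard)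
    · -- a sixfold part of `B_m × E`: Markman's sixfold theorem
      obtain ⟨ha, hGalg⟩ := hsix κ m b G hG
      have hRcard : S'.card = 2 * (q - 3) := by
        have h := Finset.card_union_of_disjoint hGS; rw [hq, ha] at h; omega
      have haq : 3 + (q - 3) = q := by
        have h := Finset.card_union_of_disjoint hGS; rw [hq, ha] at h; omega
      rw [← Finset.disjUnion_eq_union G S' hGS]
      exact weightClassesAlg_union_le_algebraicClasses hAκ haq ha hRcard hGS hGalg (ih (q - 3) hRcard)
    · -- a tenfold part of `B_{m₁} × B̄_{m₂}`: push-pull through `E ⊞ E ⊞ X`, the sixfold parts there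
      obtain ⟨ha, hGalg⟩ := weightClassesAlg_le_algebraicClasses_of_isTenPartM κ hττ hk he_conj hA
        (fun m c' G' hG' => (hsix (extM₂ κ) m c' G' hG').2) hG
      have hRcard : S'.card = 2 * (q - 5) := by
        have h := Finset.card_union_of_disjoint hGS; rw [hq, ha] at h; omega
      have haq : 5 + (q - 5) = q := by
        have h := Finset.card_union_of_disjoint hGS; rw [hq, ha] at h; omega
      rw [← Finset.disjUnion_eq_union G S' hGS]
      exact weightClassesAlg_union_le_algebraicClasses hAκ haq ha hRcard hGS hGalg (ih (q - 5) hRcard)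
  have hmem : cl ∈ ⨆ S ∈ pohlmannSetsAlg (K := fun j => Kf (multiSlots r i₀ i₁ (κ j))) (fun j => Φ (κ j)) p,
      weightClassesAlg (fun j => A (κ j)) (fun j => ι (κ j)) (2 * p) S := by
    rw [← (Pohlmann1968_thm1_cmAlgebra (fun j => Kf (multiSlots r i₀ i₁ (κ j))) (fun j => A (κ j))
      (fun j => Φ (κ j)) (fun j => ι (κ j)) (fun j => θ (κ j)) hAκ p).1]
    exact Submodule.subset_span ⟨hc, hH⟩
  have hle : (⨆ S ∈ pohlmannSetsAlg (K := fun j => Kf (multiSlots r i₀ i₁ (κ j))) (fun j => Φ (κ j)) p,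
      weightClassesAlg (fun j => A (κ j)) (fun j => ι (κ j)) (2 * p) S) ≤
      algebraicClasses (⨁ fun j => A (κ j)).X p := by
    refine iSup₂_le fun S hS => ?_
    exact key S (modelBalancedM_of_isGaloisBalancedAlg hττ hk he_sign he_conj hΦ hΨ κ hS.2) p hS.1
  exact hle hmem

/-- **The Hodge conjecture for every abelian variety dominated by a product of copies `⨁_j A(κ j)`** (frame form, `2`-transitivity,
independent positions, modulo Markman's sixfold theorem): every abelian variety isogenous to a product of copies of `E, B₁, …, B_r`
and their abelian subvarieties and quotients. [cite: Markman2025SecantWeil, Thm 1.5.1] [cite: MumfordAV1970, §19] -/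
theorem hodgeConjectureFor_of_avDominatedBy_comp_of_frameM_of_markmanSixfold_h2t
    (hM6 : Markman2025_weilClasses_algebraic_hyperbolicSixfold)
    {N : ℕ} (κ : Fin N → Fin (r + 1)) (h10 : Module.finrank ℚ (Kf i₁) = 10) (h2 : Module.finrank ℚ (Kf i₀) = 2)
    (i : Kf i₀ →+* Kf i₁) {δ : 𝓞 (Kf i₀)} {d : ℕ} (hd : 0 < d) (hδ : ((δ : Kf i₀)) ^ 2 = -(d : Kf i₀))
    (hτ : τ (δ : Kf i₀) = Complex.I * (Real.sqrt d : ℂ))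
    (hA : ∀ j, IsCMTypeRealisation (Φ j) (A j) (ι j) (θ j))
    (e : (Kf i₁ →+* ℂ) ≃ Fin 5 × Bool)
    (he_sign : ∀ s : Kf i₁ →+* ℂ, (e s).2 = true ↔ s.comp i = τ)
    (he_conj : ∀ s : Kf i₁ →+* ℂ, e (ComplexEmbedding.conjugate s) = ((e s).1, !(e s).2))
    (hP : ∀ m, ((Finset.univ : Finset (Fin 5)).filter fun a => P m a = true).card = 2) (hind : IndepPos P)
    (hΦ : ∀ (m : Fin r) (s : Kf i₁ →+* ℂ), s ∈ (Φ m.succ).1 ↔ (e s).2 = P m (e s).1)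
    (hΨ : ∀ σ : Kf i₀ →+* ℂ, σ ∈ (Φ 0).1 ↔ σ = τ)
    (h2t : ∀ a b : Fin 5, a ≠ b → ∃ ρ : ℂ ≃+* ℂ,
      (ρ : ℂ →+* ℂ).comp (e.symm (a, true)) = e.symm (0, true) ∧ (ρ : ℂ →+* ℂ).comp (e.symm (b, true)) = e.symm (1, true))
    {X : AbelianVariety ℂ} (hX : Domination.AVDominatedBy X (⨁ fun j => A (κ j))) :
    HodgeConjectureFor X.dim X.X :=
  Domination.hodgeConjectureFor_of_avDominatedBy
    (hodgeConjectureFor_biproduct_comp_of_frameM_of_markmanSixfold_h2t hM6 κ h10 h2 i hd hδ hτ hA e he_sign he_conj hP hind hΦ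
      hΨ h2t) hX

end Assembly

end Summit.HodgeConjecture.CorCM.DecicWeil23Multi

end
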